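import Mathlib
import Summits.KontsevichZagierPeriods.Zeta5Search.TopFamilyFPCasLB
import Summits.KontsevichZagierPeriods.Zeta5Search.DenomLaw.TopFamilyFPCStar
import Summits.KontsevichZagierPeriods.Zeta5Search.DenomLaw.PathAccountingShallow
import Summits.KontsevichZagierPeriods.Zeta5Search.DenomLaw.TS3RayPath
import Summits.KontsevichZagierPeriods.Zeta5Search.StaircaseCells
import HarnessLib

/-!
# ζ(5) search — PATH ACCOUNTING on the TOP linear family above the innermost block: `PathAccountingFirstPeriod`'s conclusion for `bTop t n`, ALL `t ≥ 4`, ALL `n`, every `j`; the WHOLE first period for `4 ≤ t ≤ 7`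

Cell `pub-zeta5` (HONEST FRAMING: systematic search; no irrationality claim unless certified), TRACK «DENOM-LAW» D1 prover seat
(denom-prover-d1 g16, `HOME/denom-law/prover-d1/ATTEMPT-16.md`).  The typed D2 node `DenomLaw.PathAccountingFirstPeriod` (Brown–Zudilin (28)+(30)
transported by `G ≅ S₇`, in Casoratian form: `v_p(Cas₇) ≥ ⌊d/p⌋ − N_p − min([⌊d/p⌋ ≥ 2], 5 − C⋆)`) is proved here on a TWO-PARAMETER FAMILY of dual
rays, the TOP linear family `bTop t n = bLin (t n + 2n) (t n) n = n·(3t+16; t+8, …, t+2)` (`b₀ = (3t+16)n`, `d = (2t+13)n`, pair blocks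
`(t+1)n, …, (t+11)n`; the dual rays of the diagonal directions `a = (7,13,9,12,11,15,17,12) + (t−6)·(1,…,1)`: census TOP_STAIR #1 = `t = 6`,
TOP_STAIR #9 = `t = 7`), for EVERY `t ≥ 4`, EVERY `n ≥ 1`, EVERY direction `j` and EVERY prime `p` of the range
`p > (t+1)n`, `3p > (2t+13)n`, `2p > (t+11)n` (above the innermost block and above `d/3`, inside the first period):
* §1 the integer data on the family: `⌊d/p⌋ ∈ {2, 1}` (`2p ≤ (2t+13)n` or not), the closed form of `N_p`
  (`pairFloors_tf`: `[p≤(t+2)n] + 2[p≤(t+3)n] + 2[p≤(t+4)n] + 3[p≤(t+5)n] + 3[p≤(t+6)n] + 3[p≤(t+7)n] + 2[p≤(t+8)n] + 2[p≤(t+9)n] + [p≤(t+10)n] + [p≤(t+11)n]`),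
  the family is sorted and its shifts lie in the polytope;
* §2 the assembly `pathAccounting_tf`: `⌊d/p⌋ = 2`: `(t+1,t+2]` by the LEMMA-D bonus (`v ≥ −12 = 2 − 20 + 6`), `(t+2,t+3] −11`, `(t+3,t+4] −9`, `(t+4,t+5] −9`
  (`C⋆ ≤ 9`), `(t+5,(3t+16)/3] −7` (`C⋆ ≤ 8`), `((3t+16)/3,t+6]` by the DOUBLE DROP (`−7`), `(t+6,(2t+13)/2]` by the COLLINEARITY RUNG (`−6`, `C⋆ ≤ 6`);
  `⌊d/p⌋ = 1`: `((2t+13)/2,t+7] −7 ≥ 1 − 9 − 1` (`C⋆ ≤ 6`), `(t+7,t+8] −5`, `(t+8,t+9] −3` (the STAIR cell of `StairTopFamily`), `(t+9,t+10] −1`,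
  `(t+10,t+11] 0` (`C⋆ ≤ 5`); `p > (t+11)n`: no pair block reaches `p`, so by g6's shallow kit (`FirstPeriodKit.noMultipole_of_shallow`,
  `pairFloors_eq_zero_of_shallow`, `cStar_le_of_shallow`) and (CV) without multipoles the node's value is `refund ≤ v`;
* §3 the corollaries: `pathAccountingFirstPeriod_tf` (the node's hypothesis `FirstPeriod` plus the two range bounds, every `j`, all `t ≥ 4`);
  **`pathAccountingFirstPeriod_on_tf` — for `4 ≤ t ≤ 7` the node `PathAccountingFirstPeriod` with `b := bTop t n`, binders VERBATIM, all `n ≥ 1`**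
  (there `FirstPeriod` forces `2p > (t+11)n ≥ 2(t+1)n` and `3p > (3t+33)n/2 ≥ (2t+13)n`: the WHOLE first period; `t = 7` is census TOP_STAIR #9 —
  a NEW whole-first-period ray; `t = 6` = TOP_STAIR #1 is g13's `DenomLaw/TS1RayPath` again, by a different cover), `pathAccountingFirstPeriod_on_ts9`,
  `pathAccountingFirstPeriod_tf_le9` (`t = 8, 9`: the whole first period EXCEPT the sliver `(t+1)n < p ≤ (2t+13)n/3`, where `⌊d/p⌋ = 3`, the node asks
  `−11 = casLB + 2` and of the landed rungs only the type-space origin law's structural proxy reaches it — left OPEN), and the (CV) corollary `tfRayCV`.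
WHAT IS NOT PROVED: for `t ≥ 10` the first period also contains the DEEP cells `(t+11)n/2 < p ≤ (t+1)n` (all 7 parameters and all 21 blocks reach `p`,
`⌊d/p⌋ ∈ {2,3}`, PATH value `−13`/`−12` = `casLB + 4`/`+ 5`): there the node is open on this family except on g3's CR cell `tn < p ≤ (t+1)n`… which
is `casLB + 2 = −13` only for the PATH value (`DenomLaw/TopFamilyCRCellCR`, `t ≥ 8`) — see ATTEMPT-16 for the gap statement.
MODEL/structure-side valuation bookkeeping of the cell's own rationals; nothing about ζ(5); no γ; records in print UNMOVED.
-/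

open Finset

namespace Summit.KontsevichZagierPeriods.Zeta5Search.TopFamFP

open Summit.KontsevichZagierPeriods.Zeta5Search.ClusterValuation
open Summit.KontsevichZagierPeriods.Zeta5Search.CasoratianValuation (InPolytope shift casoratian pairFloors refund)
open Summit.KontsevichZagierPeriods.Zeta5Search.WedgeDictionary (dOf)
open Summit.KontsevichZagierPeriods.Zeta5Search.ClassTypeCover
open Summit.KontsevichZagierPeriods.Zeta5Search.CellKit
open Summit.KontsevichZagierPeriods.Zeta5Search.TopFamCR (tf_zero dOf_tf inPolytope_tf)
open Summit.KontsevichZagierPeriods.Zeta5Search.StaircaseCells (bTop)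
open Summit.KontsevichZagierPeriods.Zeta5Search.DenomLaw (cStar FirstPeriod Sorted7 BlockGe)
open Summit.KontsevichZagierPeriods.Zeta5Search.DenomLaw.FirstPeriodKit
  (cStar_le_eleven shallow_pairs pairFloors_eq_zero_of_shallow noMultipole_of_shallow cStar_le_of_shallow)
open Summit.KontsevichZagierPeriods.Zeta5Search.StairTS3 (refund_le_pathHead)

/-! ## §1 The integer data on the family -/

section Arith
variable {t n p : ℕ}

/-- `b₁ = (t+8)n` (pushed casts). -/
theorem v1 (t n : ℕ) : bLin (t * n + 2 * n) (t * n) n 1 = (t : ℤ) * n + 8 * n := by rw [w1]; push_cast; ring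
/-- `b₂ = (t+7)n`. -/
theorem v2 (t n : ℕ) : bLin (t * n + 2 * n) (t * n) n 2 = (t : ℤ) * n + 7 * n := by rw [w2]; push_cast; ring
/-- `b₃ = (t+6)n`. -/
theorem v3 (t n : ℕ) : bLin (t * n + 2 * n) (t * n) n 3 = (t : ℤ) * n + 6 * n := by rw [w3]; push_cast; ring
/-- `b₄ = (t+5)n`. -/
theorem v4 (t n : ℕ) : bLin (t * n + 2 * n) (t * n) n 4 = (t : ℤ) * n + 5 * n := by rw [w4]; push_cast; ring
/-- `b₅ = (t+4)n`. -/
theorem v5 (t n : ℕ) : bLin (t * n + 2 * n) (t * n) n 5 = (t : ℤ) * n + 4 * n := by rw [w5]; push_cast; ring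
/-- `b₆ = (t+3)n`. -/
theorem v6 (t n : ℕ) : bLin (t * n + 2 * n) (t * n) n 6 = (t : ℤ) * n + 3 * n := by rw [w6]; push_cast; ring
/-- `b₇ = (t+2)n`. -/
theorem v7 (t n : ℕ) : bLin (t * n + 2 * n) (t * n) n 7 = (t : ℤ) * n + 2 * n := by rw [w7]; push_cast; ring
/-- `b₀ = (3t+16)n` (pushed casts). -/
theorem v0 (t n : ℕ) : bLin (t * n + 2 * n) (t * n) n 0 = 3 * ((t : ℤ) * n) + 16 * n := by rw [tf_zero]; push_cast; ring
/-- `d = (2t+13)n` (pushed casts). -/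
theorem vd (t n : ℕ) : dOf (bLin (t * n + 2 * n) (t * n) n) = 2 * ((t : ℤ) * n) + 13 * n := by rw [dOf_tf]; push_cast; ring

/-- The family is sorted: `b₁ ≥ b₂ ≥ … ≥ b₇`. -/
theorem sorted7_tf (t n : ℕ) : Sorted7 (bLin (t * n + 2 * n) (t * n) n) := by
  intro i hi
  simp only [Finset.mem_range] at hi
  interval_cases i <;> simp only [Nat.reduceAdd, v1, v2, v3, v4, v5, v6, v7] <;> linarith

/-- Above `(t+11)n` no pair block reaches `p` (the largest block is `b₀ − b₆ − b₇ = (t+11)n`). -/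
theorem not_blockGe67_tf (h : t * n + 11 * n < p) : ¬ BlockGe (bLin (t * n + 2 * n) (t * n) n) p 6 7 := by
  unfold BlockGe; rw [v0, v6, v7]
  have h' : ((t * n + 11 * n : ℕ) : ℤ) < p := by exact_mod_cast h
  push_cast at h'
  linarith

/-- `⌊d/p⌋ = 2` for `(2t+13)n < 3p`, `2p ≤ (2t+13)n`. -/
theorem dOf_tf_div_two (h1 : 2 * (t * n) + 13 * n < 3 * p) (h2 : 2 * p ≤ 2 * (t * n) + 13 * n) :
    dOf (bLin (t * n + 2 * n) (t * n) n) / (p : ℤ) = 2 := by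
  have hp0 : (0 : ℤ) < p := by exact_mod_cast (show 0 < p by omega)
  have h1' : ((2 * (t * n) + 13 * n : ℕ) : ℤ) < 3 * p := by exact_mod_cast h1
  have h2' : (2 * p : ℤ) ≤ ((2 * (t * n) + 13 * n : ℕ) : ℤ) := by exact_mod_cast h2
  rw [dOf_tf]
  apply le_antisymm
  · have : (((2 * (t * n) + 13 * n : ℕ) : ℤ)) / (p : ℤ) < 3 := by rw [Int.ediv_lt_iff_lt_mul hp0]; linarith
    omega
  · rw [Int.le_ediv_iff_mul_le hp0]; linarith

/-- `⌊d/p⌋ = 1` for `(2t+13)n < 2p`, `p ≤ (2t+13)n`. -/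
theorem dOf_tf_div_one (h1 : 2 * (t * n) + 13 * n < 2 * p) (h2 : p ≤ 2 * (t * n) + 13 * n) :
    dOf (bLin (t * n + 2 * n) (t * n) n) / (p : ℤ) = 1 := by
  have hp0 : (0 : ℤ) < p := by exact_mod_cast (show 0 < p by omega)
  have h1' : ((2 * (t * n) + 13 * n : ℕ) : ℤ) < 2 * p := by exact_mod_cast h1
  have h2' : (p : ℤ) ≤ ((2 * (t * n) + 13 * n : ℕ) : ℤ) := by exact_mod_cast h2
  rw [dOf_tf]
  apply le_antisymm
  · have : (((2 * (t * n) + 13 * n : ℕ) : ℤ)) / (p : ℤ) < 2 := by rw [Int.ediv_lt_iff_lt_mul hp0]; linarith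
    omega
  · rw [Int.le_ediv_iff_mul_le hp0]; linarith

/-- `⌊d/p⌋ ≤ 1` for `(2t+13)n < 2p`. -/
theorem dOf_tf_div_le_one (h1 : 2 * (t * n) + 13 * n < 2 * p) : dOf (bLin (t * n + 2 * n) (t * n) n) / (p : ℤ) ≤ 1 := by
  have hp0 : (0 : ℤ) < p := by exact_mod_cast (show 0 < p by omega)
  have h1' : ((2 * (t * n) + 13 * n : ℕ) : ℤ) < 2 * p := by exact_mod_cast h1
  rw [dOf_tf]
  have : (((2 * (t * n) + 13 * n : ℕ) : ℤ)) / (p : ℤ) < 2 := by rw [Int.ediv_lt_iff_lt_mul hp0]; linarith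
  omega

/-- `0 ≤ ⌊d/p⌋`. -/
theorem dOf_tf_div_nonneg : 0 ≤ dOf (bLin (t * n + 2 * n) (t * n) n) / (p : ℤ) := by
  rw [dOf_tf]; exact Int.ediv_nonneg (by positivity) (by positivity)

/-- **`N_p` on the family above the innermost block and inside the first period** (`(t+1)n < p`, `2p > (t+11)n`; the 21 pair blocks are
`(t+i+k−2)·n`, `1 ≤ i < k ≤ 7`, each `< 2p`, the shortest `(t+1)n < p`):
`N_p = [p≤(t+2)n] + 2[p≤(t+3)n] + 2[p≤(t+4)n] + 3[p≤(t+5)n] + 3[p≤(t+6)n] + 3[p≤(t+7)n] + 2[p≤(t+8)n] + 2[p≤(t+9)n] + [p≤(t+10)n] + [p≤(t+11)n]`. -/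
theorem pairFloors_tf (hA : t * n + n < p) (hF : t * n + 11 * n < 2 * p) :
    pairFloors (bLin (t * n + 2 * n) (t * n) n) p =
      (if p ≤ t * n + 2 * n then 1 else 0) + 2 * (if p ≤ t * n + 3 * n then 1 else 0) + 2 * (if p ≤ t * n + 4 * n then 1 else 0) +
      3 * (if p ≤ t * n + 5 * n then 1 else 0) + 3 * (if p ≤ t * n + 6 * n then 1 else 0) + 3 * (if p ≤ t * n + 7 * n then 1 else 0) +
      2 * (if p ≤ t * n + 8 * n then 1 else 0) + 2 * (if p ≤ t * n + 9 * n then 1 else 0) + (if p ≤ t * n + 10 * n then 1 else 0) +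
      (if p ≤ t * n + 11 * n then 1 else 0) := by
  have hp0 : (0 : ℤ) < p := by exact_mod_cast (show 0 < p by omega)
  have hq0 : (3 * ((t : ℤ) * n) + 16 * n - ((t : ℤ) * n + 8 * n) - ((t : ℤ) * n + 7 * n)) / (p : ℤ) = 0 := by
    rw [show 3 * ((t : ℤ) * n) + 16 * n - ((t : ℤ) * n + 8 * n) - ((t : ℤ) * n + 7 * n) = ((t * n + n : ℕ) : ℤ) by push_cast; ring]
    exact Int.ediv_eq_zero_of_lt (by positivity) (by exact_mod_cast hA)
  have hq1 : ∀ (a b : ℤ) (c : ℕ), (16 : ℤ) - a - b = c → t * n + c * n < 2 * p →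
      (3 * ((t : ℤ) * n) + 16 * n - ((t : ℤ) * n + a * n) - ((t : ℤ) * n + b * n)) / (p : ℤ) = if p ≤ t * n + c * n then 1 else 0 := by
    intro a b c h h2
    rw [show 3 * ((t : ℤ) * n) + 16 * n - ((t : ℤ) * n + a * n) - ((t : ℤ) * n + b * n) = ((t * n + c * n : ℕ) : ℤ) by
      push_cast; rw [← h]; ring]
    have h2' : ((t * n + c * n : ℕ) : ℤ) < 2 * p := by exact_mod_cast h2
    split_ifs with hc
    · have hc' : (p : ℤ) ≤ ((t * n + c * n : ℕ) : ℤ) := by exact_mod_cast hc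
      rw [Int.ediv_eq_iff_of_pos hp0]; constructor <;> linarith
    · push Not at hc
      exact Int.ediv_eq_zero_of_lt (by positivity) (by exact_mod_cast hc)
  suffices hR : ∀ R : ℤ,
      (if p ≤ t * n + 2 * n then 1 else 0) + 2 * (if p ≤ t * n + 3 * n then 1 else 0) + 2 * (if p ≤ t * n + 4 * n then 1 else 0) +
      3 * (if p ≤ t * n + 5 * n then 1 else 0) + 3 * (if p ≤ t * n + 6 * n then 1 else 0) + 3 * (if p ≤ t * n + 7 * n then 1 else 0) +
      2 * (if p ≤ t * n + 8 * n then 1 else 0) + 2 * (if p ≤ t * n + 9 * n then 1 else 0) + (if p ≤ t * n + 10 * n then 1 else 0) +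
      (if p ≤ t * n + 11 * n then 1 else 0) = R →
      pairFloors (bLin (t * n + 2 * n) (t * n) n) p = R from hR _ rfl
  intro R hR
  unfold pairFloors
  simp only [sum_range_succ, sum_range_zero, zero_add, Nat.reduceAdd, v0, v1, v2, v3, v4, v5, v6, v7, Nat.lt_irrefl, if_false,
    show (0:ℕ) < 1 by norm_num, show (0:ℕ) < 2 by norm_num, show (0:ℕ) < 3 by norm_num, show (0:ℕ) < 4 by norm_num, show (0:ℕ) < 5 by norm_num,
    show (0:ℕ) < 6 by norm_num, show (1:ℕ) < 2 by norm_num, show (1:ℕ) < 3 by norm_num, show (1:ℕ) < 4 by norm_num, show (1:ℕ) < 5 by norm_num,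
    show (1:ℕ) < 6 by norm_num, show (2:ℕ) < 3 by norm_num, show (2:ℕ) < 4 by norm_num, show (2:ℕ) < 5 by norm_num, show (2:ℕ) < 6 by norm_num,
    show (3:ℕ) < 4 by norm_num, show (3:ℕ) < 5 by norm_num, show (3:ℕ) < 6 by norm_num, show (4:ℕ) < 5 by norm_num, show (4:ℕ) < 6 by norm_num,
    show (5:ℕ) < 6 by norm_num, if_true,
    show ¬ (1:ℕ) < 0 by norm_num, show ¬ (2:ℕ) < 0 by norm_num, show ¬ (3:ℕ) < 0 by norm_num, show ¬ (4:ℕ) < 0 by norm_num, show ¬ (5:ℕ) < 0 by norm_num,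
    show ¬ (6:ℕ) < 0 by norm_num, show ¬ (2:ℕ) < 1 by norm_num, show ¬ (3:ℕ) < 1 by norm_num, show ¬ (4:ℕ) < 1 by norm_num, show ¬ (5:ℕ) < 1 by norm_num,
    show ¬ (6:ℕ) < 1 by norm_num, show ¬ (3:ℕ) < 2 by norm_num, show ¬ (4:ℕ) < 2 by norm_num, show ¬ (5:ℕ) < 2 by norm_num, show ¬ (6:ℕ) < 2 by norm_num,
    show ¬ (4:ℕ) < 3 by norm_num, show ¬ (5:ℕ) < 3 by norm_num, show ¬ (6:ℕ) < 3 by norm_num, show ¬ (5:ℕ) < 4 by norm_num, show ¬ (6:ℕ) < 4 by norm_num,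
    show ¬ (6:ℕ) < 5 by norm_num, add_zero]
  rw [hq0, hq1 8 6 2 (by norm_num) (by omega), hq1 8 5 3 (by norm_num) (by omega), hq1 8 4 4 (by norm_num) (by omega),
      hq1 8 3 5 (by norm_num) (by omega), hq1 8 2 6 (by norm_num) (by omega), hq1 7 6 3 (by norm_num) (by omega),
      hq1 7 5 4 (by norm_num) (by omega), hq1 7 4 5 (by norm_num) (by omega), hq1 7 3 6 (by norm_num) (by omega),
      hq1 7 2 7 (by norm_num) (by omega), hq1 6 5 5 (by norm_num) (by omega), hq1 6 4 6 (by norm_num) (by omega),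
      hq1 6 3 7 (by norm_num) (by omega), hq1 6 2 8 (by norm_num) (by omega), hq1 5 4 7 (by norm_num) (by omega),
      hq1 5 3 8 (by norm_num) (by omega), hq1 5 2 9 (by norm_num) (by omega), hq1 4 3 9 (by norm_num) (by omega),
      hq1 4 2 10 (by norm_num) (by omega), hq1 3 2 11 (by norm_num) (by omega), ← hR]
  ring

/-- `N_p = 20` on `(t+1)n < p ≤ (t+2)n`. -/
theorem N_c1 (hA : t * n + n < p) (hB : p ≤ t * n + 2 * n) (hF : t * n + 11 * n < 2 * p) :
    pairFloors (bLin (t * n + 2 * n) (t * n) n) p = 20 := by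
  rw [pairFloors_tf hA hF]; simp only [show p ≤ t * n + 2 * n from hB, show p ≤ t * n + 3 * n by omega, show p ≤ t * n + 4 * n by omega,
    show p ≤ t * n + 5 * n by omega, show p ≤ t * n + 6 * n by omega, show p ≤ t * n + 7 * n by omega, show p ≤ t * n + 8 * n by omega,
    show p ≤ t * n + 9 * n by omega, show p ≤ t * n + 10 * n by omega, show p ≤ t * n + 11 * n by omega, if_true]; norm_num
/-- `N_p = 19` on `(t+2)n < p ≤ (t+3)n`. -/
theorem N_c2 (hA : t * n + 2 * n < p) (hB : p ≤ t * n + 3 * n) (hF : t * n + 11 * n < 2 * p) :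
    pairFloors (bLin (t * n + 2 * n) (t * n) n) p = 19 := by
  rw [pairFloors_tf (by omega) hF]; simp only [show ¬ p ≤ t * n + 2 * n by omega, show p ≤ t * n + 3 * n from hB, show p ≤ t * n + 4 * n by omega,
    show p ≤ t * n + 5 * n by omega, show p ≤ t * n + 6 * n by omega, show p ≤ t * n + 7 * n by omega, show p ≤ t * n + 8 * n by omega,
    show p ≤ t * n + 9 * n by omega, show p ≤ t * n + 10 * n by omega, show p ≤ t * n + 11 * n by omega, if_true, if_false]; norm_num
/-- `N_p = 17` on `(t+3)n < p ≤ (t+4)n`. -/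
theorem N_c3 (hA : t * n + 3 * n < p) (hB : p ≤ t * n + 4 * n) (hF : t * n + 11 * n < 2 * p) :
    pairFloors (bLin (t * n + 2 * n) (t * n) n) p = 17 := by
  rw [pairFloors_tf (by omega) hF]; simp only [show ¬ p ≤ t * n + 2 * n by omega, show ¬ p ≤ t * n + 3 * n by omega, show p ≤ t * n + 4 * n from hB,
    show p ≤ t * n + 5 * n by omega, show p ≤ t * n + 6 * n by omega, show p ≤ t * n + 7 * n by omega, show p ≤ t * n + 8 * n by omega,
    show p ≤ t * n + 9 * n by omega, show p ≤ t * n + 10 * n by omega, show p ≤ t * n + 11 * n by omega, if_true, if_false]; norm_num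
/-- `N_p = 15` on `(t+4)n < p ≤ (t+5)n`. -/
theorem N_c4 (hA : t * n + 4 * n < p) (hB : p ≤ t * n + 5 * n) (hF : t * n + 11 * n < 2 * p) :
    pairFloors (bLin (t * n + 2 * n) (t * n) n) p = 15 := by
  rw [pairFloors_tf (by omega) hF]; simp only [show ¬ p ≤ t * n + 2 * n by omega, show ¬ p ≤ t * n + 3 * n by omega, show ¬ p ≤ t * n + 4 * n by omega,
    show p ≤ t * n + 5 * n from hB, show p ≤ t * n + 6 * n by omega, show p ≤ t * n + 7 * n by omega, show p ≤ t * n + 8 * n by omega,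
    show p ≤ t * n + 9 * n by omega, show p ≤ t * n + 10 * n by omega, show p ≤ t * n + 11 * n by omega, if_true, if_false]; norm_num
/-- `N_p = 12` on `(t+5)n < p ≤ (t+6)n` (first period). -/
theorem N_c5 (hA : t * n + 5 * n < p) (hB : p ≤ t * n + 6 * n) (hF : t * n + 11 * n < 2 * p) :
    pairFloors (bLin (t * n + 2 * n) (t * n) n) p = 12 := by
  rw [pairFloors_tf (by omega) hF]; simp only [show ¬ p ≤ t * n + 2 * n by omega, show ¬ p ≤ t * n + 3 * n by omega, show ¬ p ≤ t * n + 4 * n by omega,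
    show ¬ p ≤ t * n + 5 * n by omega, show p ≤ t * n + 6 * n from hB, show p ≤ t * n + 7 * n by omega, show p ≤ t * n + 8 * n by omega,
    show p ≤ t * n + 9 * n by omega, show p ≤ t * n + 10 * n by omega, show p ≤ t * n + 11 * n by omega, if_true, if_false]; norm_num
/-- `N_p = 9` on `(t+6)n < p ≤ (t+7)n`. -/
theorem N_c6 (hA : t * n + 6 * n < p) (hB : p ≤ t * n + 7 * n) :
    pairFloors (bLin (t * n + 2 * n) (t * n) n) p = 9 := by
  rw [pairFloors_tf (by omega) (by omega)]; simp only [show ¬ p ≤ t * n + 2 * n by omega, show ¬ p ≤ t * n + 3 * n by omega, show ¬ p ≤ t * n + 4 * n by omega,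
    show ¬ p ≤ t * n + 5 * n by omega, show ¬ p ≤ t * n + 6 * n by omega, show p ≤ t * n + 7 * n from hB, show p ≤ t * n + 8 * n by omega,
    show p ≤ t * n + 9 * n by omega, show p ≤ t * n + 10 * n by omega, show p ≤ t * n + 11 * n by omega, if_true, if_false]; norm_num
/-- `N_p = 6` on `(t+7)n < p ≤ (t+8)n`. -/
theorem N_c7 (hA : t * n + 7 * n < p) (hB : p ≤ t * n + 8 * n) :
    pairFloors (bLin (t * n + 2 * n) (t * n) n) p = 6 := by
  rw [pairFloors_tf (by omega) (by omega)]; simp only [show ¬ p ≤ t * n + 2 * n by omega, show ¬ p ≤ t * n + 3 * n by omega, show ¬ p ≤ t * n + 4 * n by omega,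
    show ¬ p ≤ t * n + 5 * n by omega, show ¬ p ≤ t * n + 6 * n by omega, show ¬ p ≤ t * n + 7 * n by omega, show p ≤ t * n + 8 * n from hB,
    show p ≤ t * n + 9 * n by omega, show p ≤ t * n + 10 * n by omega, show p ≤ t * n + 11 * n by omega, if_true, if_false]; norm_num
/-- `N_p = 4` on `(t+8)n < p ≤ (t+9)n`. -/
theorem N_c8 (hA : t * n + 8 * n < p) (hB : p ≤ t * n + 9 * n) :
    pairFloors (bLin (t * n + 2 * n) (t * n) n) p = 4 := by
  rw [pairFloors_tf (by omega) (by omega)]; simp only [show ¬ p ≤ t * n + 2 * n by omega, show ¬ p ≤ t * n + 3 * n by omega, show ¬ p ≤ t * n + 4 * n by omega,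
    show ¬ p ≤ t * n + 5 * n by omega, show ¬ p ≤ t * n + 6 * n by omega, show ¬ p ≤ t * n + 7 * n by omega, show ¬ p ≤ t * n + 8 * n by omega,
    show p ≤ t * n + 9 * n from hB, show p ≤ t * n + 10 * n by omega, show p ≤ t * n + 11 * n by omega, if_true, if_false]; norm_num
/-- `N_p = 2` on `(t+9)n < p ≤ (t+10)n`. -/
theorem N_c9 (hA : t * n + 9 * n < p) (hB : p ≤ t * n + 10 * n) :
    pairFloors (bLin (t * n + 2 * n) (t * n) n) p = 2 := by
  rw [pairFloors_tf (by omega) (by omega)]; simp only [show ¬ p ≤ t * n + 2 * n by omega, show ¬ p ≤ t * n + 3 * n by omega, show ¬ p ≤ t * n + 4 * n by omega,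
    show ¬ p ≤ t * n + 5 * n by omega, show ¬ p ≤ t * n + 6 * n by omega, show ¬ p ≤ t * n + 7 * n by omega, show ¬ p ≤ t * n + 8 * n by omega,
    show ¬ p ≤ t * n + 9 * n by omega, show p ≤ t * n + 10 * n from hB, show p ≤ t * n + 11 * n by omega, if_true, if_false]; norm_num
/-- `N_p = 1` on `(t+10)n < p ≤ (t+11)n`. -/
theorem N_c10 (hA : t * n + 10 * n < p) (hB : p ≤ t * n + 11 * n) :
    pairFloors (bLin (t * n + 2 * n) (t * n) n) p = 1 := by
  rw [pairFloors_tf (by omega) (by omega)]; simp only [show ¬ p ≤ t * n + 2 * n by omega, show ¬ p ≤ t * n + 3 * n by omega, show ¬ p ≤ t * n + 4 * n by omega,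
    show ¬ p ≤ t * n + 5 * n by omega, show ¬ p ≤ t * n + 6 * n by omega, show ¬ p ≤ t * n + 7 * n by omega, show ¬ p ≤ t * n + 8 * n by omega,
    show ¬ p ≤ t * n + 9 * n by omega, show ¬ p ≤ t * n + 10 * n by omega, show p ≤ t * n + 11 * n from hB, if_true, if_false]; norm_num

end Arith

/-! ## §2 The assembly -/

/-- **`PathAccountingFirstPeriod`'s conclusion on the TOP linear family for EVERY prime above the innermost block and above `d/3`, inside the first
period** — `(t+1)n < p`, `(2t+13)n < 3p`, `(t+11)n < 2p` — every direction `j`, all `t ≥ 4`, all `n ≥ 1`. -/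
theorem pathAccounting_tf (t n j p : ℕ) (ht : 4 ≤ t) (hn : 1 ≤ n) (hj1 : 1 ≤ j) (hj7 : j ≤ 7) (hprime : p.Prime)
    (hA : t * n + n < p) (hD : 2 * (t * n) + 13 * n < 3 * p) (hF : t * n + 11 * n < 2 * p)
    (hcas : casoratian (bLin (t * n + 2 * n) (t * n) n) j ≠ 0) :
    dOf (bLin (t * n + 2 * n) (t * n) n) / (p : ℤ) - pairFloors (bLin (t * n + 2 * n) (t * n) n) p
        - min (if 2 ≤ dOf (bLin (t * n + 2 * n) (t * n) n) / (p : ℤ) then (1 : ℤ) else 0) (5 - (cStar (bLin (t * n + 2 * n) (t * n) n) p : ℤ))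
      ≤ padicValRat p (casoratian (bLin (t * n + 2 * n) (t * n) n) j) := by
  haveI : Fact p.Prime := ⟨hprime⟩
  have htn : 4 * n ≤ t * n := Nat.mul_le_mul_right n ht
  have hp2 := odd_of_prime_fp hprime htn hn hA
  have hLB := cas_ge_casLB htn hn hj1 hj7 hprime hA hcas
  have hC11 : (cStar (bLin (t * n + 2 * n) (t * n) n) p : ℤ) ≤ 11 := by exact_mod_cast cStar_le_eleven _ p
  -- ⌊d/p⌋ = 2 : 2p ≤ (2t+13)n
  by_cases hfd2 : 2 * p ≤ 2 * (t * n) + 13 * n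
  · rw [dOf_tf_div_two hD hfd2, if_pos (le_refl _)]
    have hmin : -6 ≤ min (1 : ℤ) (5 - (cStar (bLin (t * n + 2 * n) (t * n) n) p : ℤ)) := le_min (by norm_num) (by linarith)
    by_cases h : p ≤ t * n + 2 * n
    · rw [N_c1 hA h hF]; linarith [cas_ge_c1 htn hn hj1 hj7 hprime hA h hD hF hcas]
    by_cases h' : p ≤ t * n + 3 * n
    · rw [N_c2 (by omega) h' hF]; linarith [casLB_c2 (t := t) (n := n) (p := p) htn hn (by omega) h' hF hp2]
    by_cases h : p ≤ t * n + 4 * n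
    · rw [N_c3 (by omega) h hF]; linarith [casLB_c3 (t := t) (n := n) (p := p) htn hn (by omega) h hF hp2]
    by_cases h' : p ≤ t * n + 5 * n
    · have hC : (cStar (bLin (t * n + 2 * n) (t * n) n) p : ℤ) ≤ 9 := by exact_mod_cast cStar_tf_le_nine (t := t) (n := n) (p := p) (by omega)
      have hmin' : -4 ≤ min (1 : ℤ) (5 - (cStar (bLin (t * n + 2 * n) (t * n) n) p : ℤ)) := le_min (by norm_num) (by linarith)
      rw [N_c4 (by omega) h' hF]; linarith [casLB_c4 (t := t) (n := n) (p := p) htn hn (by omega) h' hF hp2]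
    have hC8 : (cStar (bLin (t * n + 2 * n) (t * n) n) p : ℤ) ≤ 8 := by exact_mod_cast cStar_tf_le_eight (t := t) (n := n) (p := p) (by omega)
    have hmin8 : -3 ≤ min (1 : ℤ) (5 - (cStar (bLin (t * n + 2 * n) (t * n) n) p : ℤ)) := le_min (by norm_num) (by linarith)
    by_cases h : 3 * p ≤ 3 * (t * n) + 16 * n
    · rw [N_c5 (by omega) (by omega) hF]; linarith [casLB_c5a (t := t) (n := n) (p := p) htn hn (by omega) h hp2]
    by_cases h' : p ≤ t * n + 6 * n
    · rw [N_c5 (by omega) h' hF]; linarith [cas_ge_c5b htn hn hj1 hj7 hprime (by omega) h' hcas]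
    have hC6 : (cStar (bLin (t * n + 2 * n) (t * n) n) p : ℤ) ≤ 6 := by exact_mod_cast cStar_tf_le_six (t := t) (n := n) (p := p) (by omega)
    have hmin6 : -1 ≤ min (1 : ℤ) (5 - (cStar (bLin (t * n + 2 * n) (t * n) n) p : ℤ)) := le_min (by norm_num) (by linarith)
    rw [N_c6 (by omega) (by omega)]; linarith [cas_ge_c6a htn hn hj1 hj7 hprime (by omega) hfd2 hcas]
  push Not at hfd2
  -- ⌊d/p⌋ = 1 up to (t+11)n
  by_cases h11 : p ≤ t * n + 11 * n
  · rw [dOf_tf_div_one hfd2 (by omega), if_neg (by norm_num)]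
    have hC6 : (cStar (bLin (t * n + 2 * n) (t * n) n) p : ℤ) ≤ 6 := by exact_mod_cast cStar_tf_le_six (t := t) (n := n) (p := p) (by omega)
    have hmin6 : (-1 : ℤ) ≤ min (0 : ℤ) (5 - (cStar (bLin (t * n + 2 * n) (t * n) n) p : ℤ)) := le_min (by norm_num) (by linarith)
    by_cases h : p ≤ t * n + 7 * n
    · rw [N_c6 (by omega) h]; linarith [casLB_c6b (t := t) (n := n) (p := p) htn hn hfd2 h hp2]
    have hC5 : (cStar (bLin (t * n + 2 * n) (t * n) n) p : ℤ) ≤ 5 := by exact_mod_cast cStar_tf_le_five (t := t) (n := n) (p := p) (by omega)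
    have hmin0 : (0 : ℤ) ≤ min (0 : ℤ) (5 - (cStar (bLin (t * n + 2 * n) (t * n) n) p : ℤ)) := le_min le_rfl (by linarith)
    by_cases h' : p ≤ t * n + 8 * n
    · rw [N_c7 (by omega) h']; linarith [casLB_c7 (t := t) (n := n) (p := p) htn hn (by omega) h' hp2]
    by_cases h : p ≤ t * n + 9 * n
    · rw [N_c8 (by omega) h]; linarith [casLB_c8 (t := t) (n := n) (p := p) htn hn (by omega) h hp2]
    by_cases h' : p ≤ t * n + 10 * n
    · rw [N_c9 (by omega) h']; linarith [casLB_c9 (t := t) (n := n) (p := p) htn hn (by omega) h' hp2]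
    · rw [N_c10 (by omega) h11]; linarith [casLB_c10 (t := t) (n := n) (p := p) htn hn (by omega) h11 hp2]
  push Not at h11
  -- beyond (t+11)n: no pair block reaches p — the shallow kit and (CV) without multipoles
  obtain ⟨hp5, hwin⟩ := window_fp htn hn hA
  have hb := inPolytope_tf t n
  have hs := sorted7_tf t n
  have h67 := not_blockGe67_tf h11
  have hcv := ClusterValuation.casoratianLaw_of_noMultipole _ hb hj1 hj7 (inPolytope_shift_tf_j htn hn j hj1 hj7) hp5 hwin
    (noMultipole_of_shallow hb hs hp5 h67) hcas
  have hN := pairFloors_eq_zero_of_shallow hb hs h67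
  have hC : (cStar (bLin (t * n + 2 * n) (t * n) n) p : ℤ) ≤ 5 := by exact_mod_cast (cStar_le_of_shallow (shallow_pairs hs h67)).2
  have hd1 := dOf_tf_div_le_one (t := t) (n := n) (p := p) (by omega)
  have hd0 := dOf_tf_div_nonneg (t := t) (n := n) (p := p)
  rw [hN, if_neg (by omega), min_eq_left (by linarith)]
  unfold refund at hcv
  rw [hN, min_eq_right hd1] at hcv
  linarith

/-! ## §3 Corollaries: the node's own hypotheses -/

/-- On the family the node's hypothesis `FirstPeriod` forces `(t+11)n < 2p` (the pair block `b₀ − b₆ − b₇ = (t+11)n` is `< 2p`). -/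
theorem fp_bound_of_firstPeriod {t n p : ℕ} (h : FirstPeriod (bLin (t * n + 2 * n) (t * n) n) p) : t * n + 11 * n < 2 * p := by
  have := h.2 5 (by simp) 6 (by simp) (by norm_num)
  simp only [Nat.reduceAdd, v0, v6, v7] at this
  have h' : ((t * n + 11 * n : ℕ) : ℤ) < 2 * p := by push_cast; linarith
  exact_mod_cast h'

/-- **`PathAccountingFirstPeriod` on the TOP family in the node's own hypothesis `FirstPeriod` plus the two range bounds** (`p > (t+1)n`,
`3p > (2t+13)n`), every direction `j`, all `t ≥ 4`, all `n ≥ 1`. -/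
theorem pathAccountingFirstPeriod_tf (t n j p : ℕ) (ht : 4 ≤ t) (hn : 1 ≤ n) (hj1 : 1 ≤ j) (hj7 : j ≤ 7) (hprime : p.Prime)
    (hfp : FirstPeriod (bLin (t * n + 2 * n) (t * n) n) p) (hA : t * n + n < p) (hD : 2 * (t * n) + 13 * n < 3 * p)
    (hcas : casoratian (bLin (t * n + 2 * n) (t * n) n) j ≠ 0) :
    dOf (bLin (t * n + 2 * n) (t * n) n) / (p : ℤ) - pairFloors (bLin (t * n + 2 * n) (t * n) n) p
        - min (if 2 ≤ dOf (bLin (t * n + 2 * n) (t * n) n) / (p : ℤ) then (1 : ℤ) else 0) (5 - (cStar (bLin (t * n + 2 * n) (t * n) n) p : ℤ))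
      ≤ padicValRat p (casoratian (bLin (t * n + 2 * n) (t * n) n) j) :=
  pathAccounting_tf t n j p ht hn hj1 hj7 hprime hA hD (fp_bound_of_firstPeriod hfp) hcas

/-- **The node `PathAccountingFirstPeriod` restricted to the TOP family `bTop t n`, `4 ≤ t ≤ 7`, literally** (all its binders, `b := bTop t n`), all
`n ≥ 1`: for these `t` the first period `2p > (t+11)n` lies above the innermost block and above `d/3`, so the WHOLE first period is covered
(`t = 6` is TOP_STAIR #1 = g13's `DenomLaw/TS1RayPath`; `t = 7` is TOP_STAIR #9, a new whole-first-period census ray; `t = 4, 5` are new directions). -/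
theorem pathAccountingFirstPeriod_on_tf (t : ℕ) (ht4 : 4 ≤ t) (ht7 : t ≤ 7) (n p : ℕ) (hn : 1 ≤ n) :
    InPolytope (bTop t n) → Sorted7 (bTop t n) → InPolytope (shift (bTop t n) 7) → p.Prime → 5 ≤ p →
    (bTop t n 0 + 2 : ℤ) < (p : ℤ) ^ 2 → FirstPeriod (bTop t n) p → casoratian (bTop t n) 7 ≠ 0 →
      dOf (bTop t n) / (p : ℤ) - pairFloors (bTop t n) p
          - min (if 2 ≤ dOf (bTop t n) / (p : ℤ) then (1 : ℤ) else 0) (5 - (cStar (bTop t n) p : ℤ))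
        ≤ padicValRat p (casoratian (bTop t n) 7) := by
  intro _ _ _ hprime _ _ hfp hcas
  have hF := fp_bound_of_firstPeriod (t := t) (n := n) (p := p) hfp
  have htn : t * n ≤ 7 * n := Nat.mul_le_mul_right n ht7
  exact pathAccountingFirstPeriod_tf t n 7 p ht4 hn (by norm_num) (by norm_num) hprime hfp (by omega) (by omega) hcas

/-- **TOP_STAIR #9** (`a = (8,14,10,13,12,16,18,13)`, dual ray `n·(37; 15,…,9) = bTop 7 n`): the node `PathAccountingFirstPeriod` for `b := bTop 7 n`,
binders verbatim, all `n ≥ 1` — the fifth census ray on which the PATH node holds on the whole first period. -/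
theorem pathAccountingFirstPeriod_on_ts9 (n p : ℕ) (hn : 1 ≤ n) :
    InPolytope (bTop 7 n) → Sorted7 (bTop 7 n) → InPolytope (shift (bTop 7 n) 7) → p.Prime → 5 ≤ p →
    (bTop 7 n 0 + 2 : ℤ) < (p : ℤ) ^ 2 → FirstPeriod (bTop 7 n) p → casoratian (bTop 7 n) 7 ≠ 0 →
      dOf (bTop 7 n) / (p : ℤ) - pairFloors (bTop 7 n) p
          - min (if 2 ≤ dOf (bTop 7 n) / (p : ℤ) then (1 : ℤ) else 0) (5 - (cStar (bTop 7 n) p : ℤ))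
        ≤ padicValRat p (casoratian (bTop 7 n) 7) :=
  pathAccountingFirstPeriod_on_tf 7 (by norm_num) (by norm_num) n p hn

/-- **`t = 8, 9`**: the node for `b := bTop t n` on the whole first period EXCEPT the sliver `(t+1)n < p ≤ (2t+13)n/3` (where `⌊d/p⌋ = 3`): binders
verbatim plus `(2t+13)n < 3p`, all `n ≥ 1` (for `t ≤ 9` the first period lies above the innermost block by itself). -/
theorem pathAccountingFirstPeriod_tf_le9 (t : ℕ) (ht4 : 4 ≤ t) (ht9 : t ≤ 9) (n p : ℕ) (hn : 1 ≤ n)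
    (hD : 2 * (t * n) + 13 * n < 3 * p) :
    InPolytope (bTop t n) → Sorted7 (bTop t n) → InPolytope (shift (bTop t n) 7) → p.Prime → 5 ≤ p →
    (bTop t n 0 + 2 : ℤ) < (p : ℤ) ^ 2 → FirstPeriod (bTop t n) p → casoratian (bTop t n) 7 ≠ 0 →
      dOf (bTop t n) / (p : ℤ) - pairFloors (bTop t n) p
          - min (if 2 ≤ dOf (bTop t n) / (p : ℤ) then (1 : ℤ) else 0) (5 - (cStar (bTop t n) p : ℤ))
        ≤ padicValRat p (casoratian (bTop t n) 7) := by
  intro _ _ _ hprime _ _ hfp hcas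
  have hF := fp_bound_of_firstPeriod (t := t) (n := n) (p := p) hfp
  have htn : t * n ≤ 9 * n := Nat.mul_le_mul_right n ht9
  exact pathAccountingFirstPeriod_tf t n 7 p ht4 hn (by norm_num) (by norm_num) hprime hfp (by omega) hD hcas

/-- **(CV) on the TOP family above the innermost block, every direction `j`, all `t ≥ 4`, all `n`** (a corollary: the (CV) value never exceeds the
PATH value): for every prime `p` with `(t+1)n < p`, `(2t+13)n < 3p`, `(t+11)n < 2p` and `Cas_j(bTop t n) ≠ 0`, `refund − N_p ≤ v_p(Cas_j(bTop t n))`. -/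
theorem tfRayCV (t n j p : ℕ) (ht : 4 ≤ t) (hn : 1 ≤ n) (hj1 : 1 ≤ j) (hj7 : j ≤ 7) (hprime : p.Prime)
    (hA : t * n + n < p) (hD : 2 * (t * n) + 13 * n < 3 * p) (hF : t * n + 11 * n < 2 * p)
    (hcas : casoratian (bLin (t * n + 2 * n) (t * n) n) j ≠ 0) :
    refund (bLin (t * n + 2 * n) (t * n) n) p - pairFloors (bLin (t * n + 2 * n) (t * n) n) p
      ≤ padicValRat p (casoratian (bLin (t * n + 2 * n) (t * n) n) j) := by
  linarith [refund_le_pathHead (bLin (t * n + 2 * n) (t * n) n) p (5 - (cStar (bLin (t * n + 2 * n) (t * n) n) p : ℤ)),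
    pathAccounting_tf t n j p ht hn hj1 hj7 hprime hA hD hF hcas]

end Summit.KontsevichZagierPeriods.Zeta5Search.TopFamFP
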